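import Literature.NumberTheory.EllipticCurves.BinaryQuarticFiniteFieldSolubilityProofs
import Literature.NumberTheory.EllipticCurves.BinaryQuarticHenselSolubility
import HarnessLib

/-!
# Good reduction implies local solubility: `p ∤ Δ(f)`, `p ≥ 5` `⇒` `f` is `ℚ_p`-soluble
# (Bhargava–Shankar, proof of Prop. 5.13 / Prop. 3.18)

`Proofs` companion (theorems only: no definitions, no named facts) of `BinaryQuarticForms.lean`,
combining `BinaryQuarticFiniteFieldSolubilityProofs.lean` (every quartic with `Δ ≠ 0` over `𝔽_p`,
`p ≠ 2, 3`, has an `𝔽_p`-point on `z² = f(x,y)`) with the Hensel lifting of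
`BinaryQuarticHenselSolubility.lean` (`BinaryQuartic.isSoluble_of_smooth_point_mod_p`).

Source. M. Bhargava, A. Shankar, *Binary quartic forms having bounded invariants, and the
boundedness of the average rank of elliptic curves*, Ann. of Math. (2) 181 (2015) 191–242, proof
of Prop. 5.13 of the held arXiv text `arXiv:1006.1002v2` (= Prop. 3.18 of the published version):
a form that is not `ℚ_p`-soluble at a (large) prime `p` has `p² ∣ Δ(f)`; in particular
*"if `p ∤ Δ(f)` then `f` is `ℚ_p`-soluble"* ("see [Cremona, *Algorithms for modular elliptic
curves*]": the reduction of the genus-one curve `z² = f(x,y)` is smooth, has an `𝔽_p`-point, and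
the point lifts). Proved here for every prime `p ≥ 5`:

* `BinaryQuartic.isSoluble_coe_of_not_dvd_disc` — for `f ∈ V_{ℤ_p}` with `p ∤ Δ(f)`, `f` is
  `ℚ_p`-soluble;
* `BinaryQuartic.isSoluble_padic_of_not_dvd_disc` — for an integral `f` with `p ∤ Δ(f)`, `f` is
  `ℚ_p`-soluble.

The `𝔽_p`-point `(x̄ : ȳ : z̄)` is moved to the chart `y = 1` (or, if `ȳ = 0`, to the chart of the
reversed form `f(y, x)`), lifted arbitrarily to `ℤ_p`, and is smooth because a singular point of
`z² = f(x, 1)` modulo `p` (`z̄ = 0`, `f(t̄,1) = ∂f/∂x(t̄,1) = 0`) would force `16Δ(f) ≡ 0`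
(`BinaryQuartic.sixteen_mul_disc_eq`).

## References

* M. Bhargava, A. Shankar, Ann. of Math. (2) 181 (2015), proof of Prop. 5.13 (arXiv:1006.1002v2
  numbering) = Prop. 3.18 (published). [cite: BhargavaShankarAnnals2015, Prop. 5.13 (arXiv:1006.1002v2 numbering)]
-/

noncomputable section

open scoped Classical

namespace Literature.NumberTheory.EllipticCurves

namespace BinaryQuartic

/-- Reversal `(a,b,c,d,e) ↦ (e,d,c,b,a)` preserves `I`. [folklore] -/
theorem I_reverse {R : Type*} [CommRing R] (f : BinaryQuartic R) :
    (⟨f.e, f.d, f.c, f.b, f.a⟩ : BinaryQuartic R).I = f.I := by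
  simp only [I]; ring

/-- Reversal `(a,b,c,d,e) ↦ (e,d,c,b,a)` preserves `J`. [folklore] -/
theorem J_reverse {R : Type*} [CommRing R] (f : BinaryQuartic R) :
    (⟨f.e, f.d, f.c, f.b, f.a⟩ : BinaryQuartic R).J = f.J := by
  simp only [J]; ring

variable {p : ℕ} [Fact p.Prime]

/-- `2 ≠ 0` and `3 ≠ 0` in `𝔽_p` for `p ≥ 5`. [folklore] -/
theorem two_three_ne_zero_zmod (hp : 5 ≤ p) : (2 : ZMod p) ≠ 0 ∧ (3 : ZMod p) ≠ 0 := by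
  constructor
  · intro h
    have h' : ((2 : ℕ) : ZMod p) = 0 := by exact_mod_cast h
    rw [CharP.cast_eq_zero_iff (ZMod p) p] at h'
    have := Nat.le_of_dvd (by norm_num) h'
    omega
  · intro h
    have h' : ((3 : ℕ) : ZMod p) = 0 := by exact_mod_cast h
    rw [CharP.cast_eq_zero_iff (ZMod p) p] at h'
    have := Nat.le_of_dvd (by norm_num) h'
    omega

/-- `x ↦ x mod p` kills exactly the multiples of `p`. [folklore] -/
theorem toZMod_eq_zero_iff (x : ℤ_[p]) : PadicInt.toZMod x = 0 ↔ (p : ℤ_[p]) ∣ x := by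
  rw [← RingHom.mem_ker, PadicInt.ker_toZMod, PadicInt.maximalIdeal_eq_span_p,
    Ideal.mem_span_singleton]

/-- **Hensel step.** If `f ∈ V_{ℤ_p}` (`p ≠ 2, 3`) has nondegenerate reduction
(`4I³ ≢ J² (mod p)`) and `z̄² = f̄(t̄, 1)` has a solution in `𝔽_p`, then `f` is `ℚ_p`-soluble: any
lift `(t, w)` is a smooth point modulo `p`, since `w ≡ 0`, `f(t,1) ≡ ∂f/∂x(t,1) ≡ 0` would give
`16Δ(f) ≡ 0`. [cite: BhargavaShankarAnnals2015, Prop. 5.13, proof (arXiv:1006.1002v2 numbering)] -/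
theorem isSoluble_coe_of_point_mod_p (hp2 : (2 : ZMod p) ≠ 0) (hp3 : (3 : ZMod p) ≠ 0)
    (f : BinaryQuartic ℤ_[p])
    (hΔ : 4 * (f.map PadicInt.toZMod).I ^ 3 - (f.map PadicInt.toZMod).J ^ 2 ≠ 0)
    {t z : ZMod p} (h : z ^ 2 = (f.map PadicInt.toZMod).eval t 1) :
    (f.map PadicInt.Coe.ringHom).IsSoluble := by
  have hp : p ≠ 2 := by
    rintro rfl
    apply hp2
    have : ((2 : ℕ) : ZMod 2) = 0 := (CharP.cast_eq_zero_iff (ZMod 2) 2 2).mpr dvd_rfl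
    exact_mod_cast this
  obtain ⟨t', ht'⟩ := ZMod.ringHom_surjective (PadicInt.toZMod (p := p)) t
  obtain ⟨w, hw⟩ := ZMod.ringHom_surjective (PadicInt.toZMod (p := p)) z
  have hred : PadicInt.toZMod (f.eval t' 1) = (f.map PadicInt.toZMod).eval t 1 := by
    rw [← eval_map, ht', map_one]
  refine isSoluble_of_smooth_point_mod_p hp f (t := t') (w := w) ?_ ?_
  · rw [← toZMod_eq_zero_iff, map_sub, map_pow, hw, hred, h, sub_self]
  · by_contra hcon
    simp only [not_or, not_not] at hcon
    obtain ⟨hw0, hder⟩ := hcon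
    have hz0 : z = 0 := by rw [← hw, toZMod_eq_zero_iff]; exact hw0
    -- `f̄(t,1) = 0` and `∂f̄/∂x(t,1) = 0`
    set g := f.map (PadicInt.toZMod (p := p)) with hg
    have h0 : g.eval t 1 = 0 := by rw [← h, hz0]; ring
    have h1 : 4 * g.a * t ^ 3 + 3 * g.b * t ^ 2 + 2 * g.c * t + g.d = 0 := by
      have := (toZMod_eq_zero_iff _).mpr hder
      simpa [hg, ht', map_ofNat] using this
    have h2' : g.b * t ^ 3 + 2 * g.c * t ^ 2 + 3 * g.d * t + 4 * g.e = 0 := by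
      rw [euler_identity, h0, h1]; ring
    have h16 := sixteen_mul_disc_eq g t
    rw [h1, h2', mul_zero, mul_zero, add_zero] at h16
    have hsixteen : (16 : ZMod p) ≠ 0 := by
      rw [show (16 : ZMod p) = 2 * 2 * 2 * 2 by norm_num]
      exact mul_ne_zero (mul_ne_zero (mul_ne_zero hp2 hp2) hp2) hp2
    have hdisc : g.disc = 0 := (mul_eq_zero.mp h16).resolve_left hsixteen
    apply hΔ
    rw [← twentySeven_mul_disc, hdisc, mul_zero]

/-- **Good reduction implies `ℚ_p`-solubility** (Bhargava–Shankar, proof of Prop. 5.13: "if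
`p ∤ Δ(f)` then `f` is `ℚ_p`-soluble"), for `f ∈ V_{ℤ_p}` and every prime `p ≥ 5`: the reduction
`z² = f̄(x,y)` has an `𝔽_p`-point (`isSoluble_of_disc_ne_zero_of_finite`), which lifts.
[cite: BhargavaShankarAnnals2015, Prop. 5.13, proof (arXiv:1006.1002v2 numbering)] -/
theorem isSoluble_coe_of_not_dvd_disc (hp : 5 ≤ p) (f : BinaryQuartic ℤ_[p])
    (hΔ : ¬ (p : ℤ_[p]) ∣ f.disc) : (f.map PadicInt.Coe.ringHom).IsSoluble := by
  obtain ⟨hp2, hp3⟩ := two_three_ne_zero_zmod hp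
  set g := f.map (PadicInt.toZMod (p := p)) with hg
  have hgΔ : g.disc ≠ 0 := by
    rw [hg, disc_map, ne_eq, toZMod_eq_zero_iff]; exact hΔ
  have hIJ : 4 * g.I ^ 3 - g.J ^ 2 ≠ 0 := four_I_cube_sub_J_sq_ne_zero hgΔ hp3
  obtain ⟨x, y, z, hxy, hz⟩ := isSoluble_of_disc_ne_zero_of_finite hp2 hp3 hgΔ
  by_cases hy : y = 0
  · -- the point `(x̄ : 0 : z̄)`, `x̄ ≠ 0`: use the reversed form `f(y, x)` and its point `(0 : x̄ : z̄)`
    have hx : x ≠ 0 := by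
      rcases hxy with hx | hy'
      · exact hx
      · exact absurd hy hy'
    set fr : BinaryQuartic ℤ_[p] := ⟨f.e, f.d, f.c, f.b, f.a⟩ with hfr
    have hgr : fr.map PadicInt.toZMod = ⟨g.e, g.d, g.c, g.b, g.a⟩ := by
      rw [hfr, map_reverse]; rfl
    have hIJr : 4 * (fr.map PadicInt.toZMod).I ^ 3 - (fr.map PadicInt.toZMod).J ^ 2 ≠ 0 := by
      rw [hgr, I_reverse, J_reverse]; exact hIJ
    -- scale `(0 : x̄ : z̄)` to `(0 : 1 : z̄/x̄²)`
    have hpt : (z / x ^ 2) ^ 2 = (fr.map PadicInt.toZMod).eval 0 1 := by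
      rw [hy] at hz
      rw [hgr, eval_reverse]
      have hsc := eval_smul_smul g x⁻¹ x 0
      rw [inv_mul_cancel₀ hx, mul_zero] at hsc
      rw [hsc, ← hz]
      field_simp
    have hsol := isSoluble_coe_of_point_mod_p hp2 hp3 fr hIJr hpt
    have hrev : fr.map PadicInt.Coe.ringHom =
        ⟨(f.map PadicInt.Coe.ringHom).e, (f.map PadicInt.Coe.ringHom).d,
          (f.map PadicInt.Coe.ringHom).c, (f.map PadicInt.Coe.ringHom).b,
          (f.map PadicInt.Coe.ringHom).a⟩ := by
      rw [hfr, map_reverse]; rfl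
    rw [hrev, isSoluble_reverse_iff] at hsol
    exact hsol
  · -- the point `(x̄ : ȳ : z̄)`, `ȳ ≠ 0`: scale to `(x̄/ȳ : 1 : z̄/ȳ²)`
    have hpt : (z / y ^ 2) ^ 2 = (f.map PadicInt.toZMod).eval (x / y) 1 := by
      have hsc := eval_smul_smul g y⁻¹ x y
      rw [inv_mul_cancel₀ hy] at hsc
      rw [← hg, show x / y = y⁻¹ * x by rw [div_eq_inv_mul], hsc, ← hz]
      field_simp
    exact isSoluble_coe_of_point_mod_p hp2 hp3 f hIJ hpt

/-- **Good reduction implies `ℚ_p`-solubility, for integral forms**: if `f ∈ V_ℤ` and `p ≥ 5` is a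
prime with `p ∤ Δ(f)`, then `z² = f(x,y)` has a nonzero solution over `ℚ_p` (the `p ∤ Δ` case of
Bhargava–Shankar's Prop. 5.13 / Prop. 3.18: such `f` is not "bad at `p`" for solubility).
[cite: BhargavaShankarAnnals2015, Prop. 5.13, proof (arXiv:1006.1002v2 numbering)] -/
theorem isSoluble_padic_of_not_dvd_disc (hp : 5 ≤ p) (f : BinaryQuartic ℤ)
    (hΔ : ¬ (p : ℤ) ∣ f.disc) : (f.map (Int.castRingHom ℚ_[p])).IsSoluble := by
  set f' := f.map (Int.castRingHom ℤ_[p]) with hf'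
  have hΔ' : ¬ (p : ℤ_[p]) ∣ f'.disc := by
    rw [hf', disc_map, eq_intCast, ← PadicInt.norm_lt_one_iff_dvd, PadicInt.norm_int_lt_one_iff_dvd]
    exact hΔ
  have h := isSoluble_coe_of_not_dvd_disc hp f' hΔ'
  have hmap : f'.map PadicInt.Coe.ringHom = f.map (Int.castRingHom ℚ_[p]) := by
    rw [hf']
    ext <;> simp [map]
  rwa [hmap] at h

end BinaryQuartic

end Literature.NumberTheory.EllipticCurves

end
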